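import Mathlib

/-!
# Power certificates: a one-petal Hölder-type inequality implies (RES0′) for EVERY number of petals

(prove-1 gen 55, memo FINDING-PHI0-prove1-g55 §3.)  A family of petals `j ∈ S` has values `V_j ≥ 0` and, for each budget `i` (cells and
faces of the block cube), a normalised usage `u_{j,i} ≥ 1`; the budgets are `∏_j u_{j,i} ≤ cap_i` (Lemma-A instances: total usage at most one
full petal's).  A POWER CERTIFICATE is a vector of exponents `λ_i ≥ 0` with

  (i)  `V_j ≤ ∏_i u_{j,i}^{λ_i}` for every petal (a one-petal inequality), and   (ii) `∏_i cap_i^{λ_i} ≤ T`.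

Then `∏_j V_j ≤ T` for EVERY finite family obeying the budgets (`prod_le_of_power_certificate`): the bound tensorises.  `λ` is a vector of
Lagrange multipliers of the fractional relaxation of the budgeted maximisation; numerically such certificates exist at > 96 % of the parameter
points of the two-linked-systems inequality (RES0′) with the six cell/edge budgets and at > 99 % with the face `{w=1}` added, and a hybrid form
(`prod_le_of_power_certificate_exempt`: a bounded set of "big" petals kept exact, the certificate applied to the rest on the remaining budget)
at every tested point (memo §3(c)).  These two theorems are the `n`-free reduction; the analytic content is the certificate itself. [this work]
-/

namespace Summit.CriticalPhenomena.PercolationContinuityZ3.Theorems.SunflowerPartition.SafeCalc.LinkedCurrency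

open Finset

/-- **A power certificate bounds every budget-feasible family.**  Budgets `i ∈ I`, petals `j ∈ S` with usages `u j i ≥ 1` and values
`0 ≤ V j ≤ ∏_i (u j i)^(λ i)`; if `∏_j u j i ≤ cap i` for every budget and `∏_i (cap i)^(λ i) ≤ T`, then `∏_j V j ≤ T`. [this work] -/
theorem prod_le_of_power_certificate {ι κ : Type*} (I : Finset κ) (S : Finset ι) (u : ι → κ → ℝ) (V : ι → ℝ) (cap lam : κ → ℝ) (T : ℝ)
    (hlam : ∀ i ∈ I, 0 ≤ lam i) (hu : ∀ j ∈ S, ∀ i ∈ I, 1 ≤ u j i) (hV : ∀ j ∈ S, 0 ≤ V j)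
    (hcert : ∀ j ∈ S, V j ≤ ∏ i ∈ I, (u j i) ^ (lam i))
    (hbudget : ∀ i ∈ I, ∏ j ∈ S, u j i ≤ cap i) (hT : ∏ i ∈ I, (cap i) ^ (lam i) ≤ T) :
    ∏ j ∈ S, V j ≤ T := by
  have h1 : ∏ j ∈ S, V j ≤ ∏ j ∈ S, ∏ i ∈ I, (u j i) ^ (lam i) := Finset.prod_le_prod hV hcert
  have h2 : ∏ j ∈ S, ∏ i ∈ I, (u j i) ^ (lam i) = ∏ i ∈ I, (∏ j ∈ S, u j i) ^ (lam i) := by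
    rw [Finset.prod_comm]
    exact Finset.prod_congr rfl (fun i hi => Real.finsetProd_rpow S (fun j => u j i) (fun j hj => zero_le_one.trans (hu j hj i hi)) (lam i))
  have h3 : ∏ i ∈ I, (∏ j ∈ S, u j i) ^ (lam i) ≤ ∏ i ∈ I, (cap i) ^ (lam i) := by
    apply Finset.prod_le_prod
    · intro i hi
      exact Real.rpow_nonneg (Finset.prod_nonneg (fun j hj => zero_le_one.trans (hu j hj i hi))) _
    · intro i hi
      exact Real.rpow_le_rpow (Finset.prod_nonneg (fun j hj => zero_le_one.trans (hu j hj i hi))) (hbudget i hi) (hlam i hi)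
  calc ∏ j ∈ S, V j ≤ ∏ j ∈ S, ∏ i ∈ I, (u j i) ^ (lam i) := h1
    _ = ∏ i ∈ I, (∏ j ∈ S, u j i) ^ (lam i) := h2
    _ ≤ ∏ i ∈ I, (cap i) ^ (lam i) := h3
    _ ≤ T := hT

/-- **Hybrid form: a set `B ⊆ S` of exempt ("big") petals kept exact.**  If the certificate (i) holds for the petals outside `B`, and the exact
product of the exempt petals times the certificate value of the budget LEFT by them is at most `T`, i.e.
`(∏_{j∈B} V j) · ∏_i (cap i / ∏_{j∈B} u j i)^(λ i) ≤ T`, then `∏_{j∈S} V j ≤ T`. [this work] -/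
theorem prod_le_of_power_certificate_exempt {ι κ : Type*} [DecidableEq ι] (I : Finset κ) (S B : Finset ι) (hBS : B ⊆ S)
    (u : ι → κ → ℝ) (V : ι → ℝ) (cap lam : κ → ℝ) (T : ℝ)
    (hlam : ∀ i ∈ I, 0 ≤ lam i) (hu : ∀ j ∈ S, ∀ i ∈ I, 1 ≤ u j i) (hV : ∀ j ∈ S, 0 ≤ V j)
    (hcert : ∀ j ∈ S \ B, V j ≤ ∏ i ∈ I, (u j i) ^ (lam i))
    (hbudget : ∀ i ∈ I, ∏ j ∈ S, u j i ≤ cap i)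
    (hT : (∏ j ∈ B, V j) * ∏ i ∈ I, (cap i / ∏ j ∈ B, u j i) ^ (lam i) ≤ T) :
    ∏ j ∈ S, V j ≤ T := by
  -- split S = B ∪ (S \ B) and apply the basic certificate to S \ B with the remaining budgets
  have hsplit : ∏ j ∈ S, V j = (∏ j ∈ B, V j) * ∏ j ∈ S \ B, V j := by
    rw [← Finset.prod_sdiff hBS, mul_comm]
  have hBpos : ∀ i ∈ I, 0 < ∏ j ∈ B, u j i := fun i hi =>
    Finset.prod_pos (fun j hj => zero_lt_one.trans_le (hu j (hBS hj) i hi))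
  have hrest : ∏ j ∈ S \ B, V j ≤ ∏ i ∈ I, (cap i / ∏ j ∈ B, u j i) ^ (lam i) := by
    apply prod_le_of_power_certificate I (S \ B) u V (fun i => cap i / ∏ j ∈ B, u j i) lam
      _ hlam (fun j hj i hi => hu j (Finset.mem_sdiff.1 hj).1 i hi) (fun j hj => hV j (Finset.mem_sdiff.1 hj).1) hcert
    · intro i hi
      rw [le_div_iff₀ (hBpos i hi)]
      have := hbudget i hi
      rw [← Finset.prod_sdiff hBS] at this
      linarith [this]
    · exact le_refl _
  have hBV : 0 ≤ ∏ j ∈ B, V j := Finset.prod_nonneg (fun j hj => hV j (hBS hj))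
  rw [hsplit]
  exact (mul_le_mul_of_nonneg_left hrest hBV).trans hT

end Summit.CriticalPhenomena.PercolationContinuityZ3.Theorems.SunflowerPartition.SafeCalc.LinkedCurrency
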